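import Summits.BirchSwinnertonDyer.BirchSwinnertonDyer.Theorems.ThetaPartnerAtTwoSignedControlAtTwoPlusGenStepCurveTwo
import Summits.BirchSwinnertonDyer.Rank1Residual.Additive.KobayashiLayerSaturation
import HarnessLib

/-!
# The PLUS tower at `2`, IX: the generation step for ALL points `E(ℚ₂(v_{N+1}))` (not only `Ê`), via prime-to-`2` saturation
# `3•P ∈ Ê` (K4 `SignedControlAtTwo`, stmt-BirchSwinnertonDyer-20309, line `eulerchar` v6, stub HONDA⁺@2 clause (GEN) — memo LAGPLUS-AT-2 §7 (b))

Route `ThetaPartnerAtTwo` (TP2; shared with `ResidualThetaTransportAtTwo`), crux K4, lead seat `prover-bsd-wall-tp2-p3` (g2). Sequel of VIII.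
Clause (GEN) of `stub_plusHondaSystemTwo` quantifies over ALL points of the layer (`localLayerPointsOfEmb`), not only over the formal group.
The passage is item (b) of memo §7: `E(k)/Ê(k) ↪ W̃(𝔽₂)`, of order `#W̃(𝔽₂) = 3` when `a₂ = 0` (O10's `KobayashiLayerSaturation`:
`card_smul_mem_kernel_of_mem_subfieldPoints`, `natCard_point_eq_of_tr_eq_zero`), and `P = 3•P − 2•P`.

WHAT. `plusGenStep_allPoints_of_goodSS`: `W/ℚ` globally minimal, `GoodSS W 2`, `a₂(W) = 0`, on `M_W`; any coordinatewise action; `N ≥ 2`;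
`ι` with `ι ζ_{2^{N+2}} = −ζ_{2^{N+2}}⁻¹`; a tower point `c ∈ L(ℚ₂(ζ_{2^{N+1}})) ∩ Ŵ`, `Λ(c) = ℓ_{N+1}`. Then EVERY `P ∈ L(ℚ₂(v_{N+1}))` (all points
with coordinates in the plus layer) is `B + P' + 2•R` with `B ∈ ℤ[Γ·(c + ι·c)]`, `P' ∈ L(ℚ₂(v_N)) ∩ Ŵ`, `R ∈ L(ℚ₂(v_{N+1}))` — literally the
shape `P = B + P' + 2 • R` of clause (GEN) (with `P'` in the lower layer and `R` in the same layer), in `Ω`-currency.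
HONEST FRAMING: THEOREMS ONLY (no definition, no named fact, no instance, no `sorry`); local theory at `2`; nothing about any Selmer group;
closes no item; BSD is not proved by any of this.

References: [Kobayashi2003] §8.4 (proof of Prop. 8.12); [SilvermanAEC2009] VII.2 Prop. 2.1.
-/

set_option autoImplicit false
-- the Theorems namespace of this sub repeats the summit name by design (D-0017 nested layout)
set_option linter.dupNamespace false

noncomputable section

open scoped Classical Topology NNReal IntermediateField
open Filter PowerSeries Finset Polynomial

namespace Summit.BirchSwinnertonDyer.BirchSwinnertonDyer.Theorems.SignedEC.PlusTower

open Literature.RingTheory.FormalGroups WeierstrassCurve Field Field.absoluteGaloisGroup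
open Summit.BirchSwinnertonDyer.Rank1Residual.Additive
open Summit.BirchSwinnertonDyer.Rank1Residual.Additive.PadicCyclotomicTower
open Summit.BirchSwinnertonDyer.Rank1Residual.Additive.BallEval
open Literature.NumberTheory.EllipticCurves Literature.NumberTheory.EllipticCurves.FormalGroupChart
open Literature.NumberTheory.EllipticCurves.Rank1Residual
open Summit.BirchSwinnertonDyer.BirchSwinnertonDyer.Theorems.SignedKatoOffTwo.LocalAllPrimes
open Summit.BirchSwinnertonDyer.BirchSwinnertonDyer.Theorems.SignedKatoOffTwo.LocalTwo

variable (W : WeierstrassCurve ℚ) [W.IsElliptic] [W.IsGloballyMinimal]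
  [hintΩ : (genFibΩ 2 ((integralModelInt W).map (Int.castRingHom ℤ_[2]))).IsIntegral (Valued.v (R := PadicAlgCl 2)).integer]

omit [W.IsElliptic] in
/-- **`3•P ∈ Ŵ` for every point with coordinates in a cyclotomic layer** (`GoodSS W 2`, `a₂(W) = 0`: `#W̃(𝔽₂) = 3` kills the reduction).
[cite: SilvermanAEC2009, VII.2 Prop. 2.1] -/
theorem three_smul_mem_kernel_of_goodSS (hss : GoodSS W 2) (ha : W.frobeniusTrace 2 = 0) {m : ℕ}
    {Q : (genFibΩ 2 ((integralModelInt W).map (Int.castRingHom ℤ_[2]))).toAffine.Point}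
    (hQ : Q ∈ subfieldPoints (genFibΩ 2 ((integralModelInt W).map (Int.castRingHom ℤ_[2]))) (layer 2 m).toSubfield
      coeffs_mem_layer) :
    3 • Q ∈ kernel (Valued.v (R := PadicAlgCl 2)) (genFibΩ 2 ((integralModelInt W).map (Int.castRingHom ℤ_[2]))) := by
  haveI := isElliptic_toZMod_twoAdicModel W hss.1
  have htr : Literature.NumberTheory.EllipticCurves.HasseManin.tr
      (((integralModelInt W).map (Int.castRingHom ℤ_[2])).map PadicInt.toZMod) = 0 := by
    rw [tr_twoAdicModel W hss.1, ha]
  have h : Nat.card (((integralModelInt W).map (Int.castRingHom ℤ_[2])).map PadicInt.toZMod).toAffine.Point • Q ∈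
      kernel (Valued.v (R := PadicAlgCl 2)) (genFibΩ 2 ((integralModelInt W).map (Int.castRingHom ℤ_[2]))) :=
    card_smul_mem_kernel_of_mem_subfieldPoints ((integralModelInt W).map (Int.castRingHom ℤ_[2])) hQ
  rw [natCard_point_eq_of_tr_eq_zero _ htr, show (2 + 1 : ℕ) = 3 from rfl] at h
  assumption

/-- **THE GENERATION STEP ALONG THE PLUS TOWER FOR ALL POINTS** (`GoodSS W 2`, `a₂(W) = 0`, `N ≥ 2`): every point `P` of `W` with
coordinates in `ℚ₂(v_{N+1})` (on `M_W ⊗ ℚ̄₂`) is `B + P' + 2•R` with `B ∈ ℤ[Γ·(c + ι·c)]`, `P' ∈ L(ℚ₂(v_N)) ∩ Ŵ`, `R ∈ L(ℚ₂(v_{N+1}))`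
(`3•P ∈ Ŵ` by saturation, file VIII for `3•P`, and `P = 3•P − 2•P`). [cite: Kobayashi2003, Prop. 8.12] -/
theorem plusGenStep_allPoints_of_goodSS (hss : GoodSS W 2) (ha : W.frobeniusTrace 2 = 0)
    (act : absoluteGaloisGroup ℚ_[2] → (genFibΩ 2 ((integralModelInt W).map (Int.castRingHom ℤ_[2]))).toAffine.Point →
      (genFibΩ 2 ((integralModelInt W).map (Int.castRingHom ℤ_[2]))).toAffine.Point)
    (hact0 : ∀ σ, act σ 0 = 0)
    (hact : ∀ σ (x y : PadicAlgCl 2) (h : (genFibΩ 2 ((integralModelInt W).map (Int.castRingHom ℤ_[2]))).toAffine.Nonsingular x y),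
      ∃ h', act σ (Affine.Point.some x y h) = Affine.Point.some (σ • x) (σ • y) h')
    {N : ℕ} (hN : 2 ≤ N) {ι : absoluteGaloisGroup ℚ_[2]}
    (hι : toAlgEquiv ℚ_[2] ι (zeta 2 (N + 2)) = zeta 2 (N + 2) ^ (2 ^ (N + 1) + (2 ^ (N + 2) - 1)))
    {c : (genFibΩ 2 ((integralModelInt W).map (Int.castRingHom ℤ_[2]))).toAffine.Point}
    (hcL : c ∈ subfieldPoints (genFibΩ 2 ((integralModelInt W).map (Int.castRingHom ℤ_[2]))) (layer 2 (N + 1)).toSubfield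
      coeffs_mem_layer)
    (hck : c ∈ kernel (Valued.v (R := PadicAlgCl 2)) (genFibΩ 2 ((integralModelInt W).map (Int.castRingHom ℤ_[2]))))
    (hcℓ : ptLogΩ 2 ((integralModelInt W).map (Int.castRingHom ℤ_[2])) c = ell 2 (N + 1))
    {P : (genFibΩ 2 ((integralModelInt W).map (Int.castRingHom ℤ_[2]))).toAffine.Point}
    (hP : P ∈ subfieldPoints (genFibΩ 2 ((integralModelInt W).map (Int.castRingHom ℤ_[2])))
      (ℚ_[2]⟮zeta 2 (N + 1) + (zeta 2 (N + 1))⁻¹ - 2⟯).toSubfield (coeffs_mem_adjoin _ _)) :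
    ∃ B ∈ AddSubgroup.closure (Set.range fun σ : absoluteGaloisGroup ℚ_[2] ↦ act σ (c + act ι c)),
      ∃ P' ∈ subfieldPoints (genFibΩ 2 ((integralModelInt W).map (Int.castRingHom ℤ_[2])))
          (ℚ_[2]⟮zeta 2 N + (zeta 2 N)⁻¹ - 2⟯).toSubfield (coeffs_mem_adjoin _ _),
        ∃ R ∈ subfieldPoints (genFibΩ 2 ((integralModelInt W).map (Int.castRingHom ℤ_[2])))
            (ℚ_[2]⟮zeta 2 (N + 1) + (zeta 2 (N + 1))⁻¹ - 2⟯).toSubfield (coeffs_mem_adjoin _ _),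
          P' ∈ kernel (Valued.v (R := PadicAlgCl 2)) (genFibΩ 2 ((integralModelInt W).map (Int.castRingHom ℤ_[2]))) ∧
          P = B + P' + 2 • R := by
  have hle : (ℚ_[2]⟮zeta 2 (N + 1) + (zeta 2 (N + 1))⁻¹ - 2⟯).toSubfield ≤ (layer 2 (N + 1)).toSubfield :=
    adjoin_v_le_layer (N + 1)
  have h3L : 3 • P ∈ subfieldPoints (genFibΩ 2 ((integralModelInt W).map (Int.castRingHom ℤ_[2])))
      (ℚ_[2]⟮zeta 2 (N + 1) + (zeta 2 (N + 1))⁻¹ - 2⟯).toSubfield (coeffs_mem_adjoin _ _) :=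
    (subfieldPoints _ _ _).nsmul_mem hP 3
  have h3k : 3 • P ∈ kernel (Valued.v (R := PadicAlgCl 2)) (genFibΩ 2 ((integralModelInt W).map (Int.castRingHom ℤ_[2]))) :=
    three_smul_mem_kernel_of_goodSS W hss ha (mem_subfieldPoints_of_le _ coeffs_mem_layer hle hP)
  obtain ⟨B, hB, R, hRL, -, hL, hk⟩ := plusGenStep_of_goodSS W hss ha act hact0 hact hN hι hcL hck hcℓ h3L h3k
  refine ⟨B, hB, 3 • P - B - 2 • R, hL, R - P, (subfieldPoints _ _ _).sub_mem hRL hP, hk, ?_⟩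
  have e : (3 : ℕ) • P = P + 2 • P := by rw [show (3 : ℕ) = 1 + 2 from rfl, add_nsmul, one_nsmul]
  rw [smul_sub, e]
  abel

end Summit.BirchSwinnertonDyer.BirchSwinnertonDyer.Theorems.SignedEC.PlusTower

end
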